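import Mathlib.Analysis.Complex.JensenFormula
import Literature.NumberTheory.LFunctions.SimpleZerosProofs
import Literature.NumberTheory.LFunctions.WeilZeroSum
import HarnessLib

set_option linter.dupNamespace false

/-!
# Calibration stub `stub_calibration_END_of_RH` — auxiliary file 2: too many zeros

Helpers for the calibration stub of line `cofinite-weil-index-staircase` (crux
`RuelleBand.CofiniteCriticalLine`): an entire function of exponential type in `Re s`,
`‖F(s)‖ ≤ B e^{A |Re s − 1/2|}`, that vanishes at every non-trivial zero of `ζ` is identically zero,
ASSUMING RH (so that the zeros lie on `Re s = 1/2` and Montgomery's theorem on distinct zeros is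
available):

* Jensen (`AnalyticOnNhd.sum_divisor_le`, Mathlib): a finite set of zeros of `F` in the disc
  `|s − s₀| ≤ r`, `F(s₀) ≠ 0`, has at most `log(M/|F(s₀)|)/log(R/r)` elements, `M = max_{|s−s₀|=R} |F|`;
  with `R = 2r` and the growth bound this is `O(r)`;
* the distinct zeros `ρ` of `ζ` with `0 < Im ρ ≤ T` lie in the disc of radius `T + |s₀ − 1/2|`
  about `s₀` (RH), and there are `N_d(T) ≥ (5/6 − ε) N(T)` of them for large `T`
  (`Montgomery1973_distinct_zeros_holds`), while `(T/2π) log T ≤ (1 + ε) N(T)`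
  (Riemann–von Mangoldt, `ZeroGapsProofs.eventually_mul_log_le`): `N_d(T)/T → ∞`, contradiction.
-/

noncomputable section

open Complex MeasureTheory Filter Set
open scoped BigOperators Topology ComplexConjugate Real

namespace Summit.RiemannHypothesis.RiemannHypothesis.Theorems.RuelleBandCofiniteCriticalLine

open Literature.NumberTheory.LFunctions

section Jensen

open Metric MeromorphicOn

/-- **Jensen's bound for a finite set of zeros.** Let `f` be entire, `f c ≠ 0`, `0 < r < R`,
`‖f‖ ≤ M` on the circle `|z − c| = R` (`M ≥ 1`). Then any finite set `Z` of zeros of `f` in the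
disc `|z − c| ≤ r` has `#Z ≤ log(M/‖f c‖)/log(R/r)` (Mathlib's `AnalyticOnNhd.sum_divisor_le`,
each zero carrying divisor `≥ 1`; adapted from
`Literature.Analysis.Complex.card_zeros_re_le_jensen`). [folklore] -/
theorem stub_calibration_END_of_RH_card_zeros_le {f : ℂ → ℂ} (hf : Differentiable ℂ f) {c : ℂ}
    {r R M : ℝ} (hr : 0 < r) (hrR : r < R) (hM : 1 ≤ M) (hfc : f c ≠ 0)
    (hbound : ∀ z ∈ sphere c R, ‖f z‖ ≤ M) (Z : Finset ℂ)
    (hZ : ∀ z ∈ Z, z ∈ closedBall c r ∧ f z = 0) :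
    (Z.card : ℝ) ≤ Real.log (M / ‖f c‖) / Real.log (R / r) := by
  have hR : 0 < R := hr.trans hrR
  have hfan : AnalyticOnNhd ℂ f (closedBall c |R|) := fun z _ => hf.analyticAt z
  have hJ := AnalyticOnNhd.sum_divisor_le (f := f) (c := c) (r := r) (R := R)
    (by rwa [abs_of_pos hr]) (by rwa [abs_of_pos hr, abs_of_pos hR]) hM hfan hfc
    (by rwa [abs_of_pos hR])
  rw [abs_of_pos hr] at hJ
  refine le_trans ?_ hJ
  set U := closedBall c r with hU
  have hfanU : AnalyticOnNhd ℂ f U := fun z _ => hf.analyticAt z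
  have hmer : MeromorphicOn f U := hfanU.meromorphicOn
  set D := divisor f U with hD
  have hfin : (Function.support fun u => (D u : ℝ)).Finite := by
    refine (D.finiteSupport (isCompact_closedBall _ _)).subset fun u hu => ?_
    simpa using hu
  have hcast : ((∑ᶠ u, D u : ℤ) : ℝ) = ∑ᶠ u, (D u : ℝ) :=
    map_finsum (Int.castRingHom ℝ) (D.finiteSupport (isCompact_closedBall _ _))
  rw [hcast, finsum_eq_sum_of_support_subset _ (s := hfin.toFinset) (by simp)]
  -- the divisor at a zero `x ∈ Z` is `≥ 1`
  have hDx : ∀ x ∈ Z, (1 : ℝ) ≤ D x := by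
    intro x hx
    obtain ⟨hxU, hx0⟩ := hZ x hx
    rw [hD, divisor_apply hmer hxU]
    have han : AnalyticAt ℂ f x := hfanU x hxU
    have hne_top : analyticOrderAt f x ≠ ⊤ := by
      intro htop
      rw [analyticOrderAt_eq_top] at htop
      have hpre : IsPreconnected U := (convex_closedBall c r).isPreconnected
      have hcU : c ∈ U := mem_closedBall_self hr.le
      have := hfanU.eqOn_zero_of_preconnected_of_eventuallyEq_zero hpre hxU htop hcU
      exact hfc this
    have hpos : 0 < analyticOrderAt f x := by
      rw [pos_iff_ne_zero, Ne, han.analyticOrderAt_eq_zero]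
      exact not_not.2 hx0
    obtain ⟨n, hn⟩ := ENat.ne_top_iff_exists.mp hne_top
    rw [← hn] at hpos
    have hn1 : 1 ≤ n := Nat.one_le_iff_ne_zero.2 (by rintro rfl; simp at hpos)
    rw [han.meromorphicOrderAt_eq, ← hn, ENat.map_coe, WithTop.untop₀_coe]
    exact_mod_cast hn1
  have hsub : Z ⊆ hfin.toFinset := by
    intro u hu
    rw [Set.Finite.mem_toFinset, Function.mem_support]
    linarith [hDx u hu]
  calc (Z.card : ℝ) = ∑ x ∈ Z, (1 : ℝ) := by simp
    _ ≤ ∑ x ∈ Z, (D x : ℝ) := Finset.sum_le_sum hDx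
    _ ≤ ∑ u ∈ hfin.toFinset, (D u : ℝ) :=
        Finset.sum_le_sum_of_subset_of_nonneg hsub fun u _ _ => by
          exact_mod_cast hfanU.divisor_nonneg u

end Jensen

/-- **Too many zeros (under RH)** (registered anchor of this helper file, stated binder-free).
An entire function `f` with `‖f(s)‖ ≤ B e^{A |Re s − 1/2|}`
(`A ≥ 0`) vanishing at every non-trivial zero of `ζ` is identically zero: otherwise Jensen's
inequality about a point `s₀` with `f(s₀) ≠ 0` bounds the number of distinct zeros of `ζ` with
`0 < Im ρ ≤ T` (which lie in `|s − s₀| ≤ T + |s₀ − 1/2|` by RH) by `αT + β`, contradicting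
`N_d(T) ≥ (1/2) N(T) ≥ (T/8π) log T` for large `T` (Montgomery 1973 on RH,
`Montgomery1973_distinct_zeros_holds`; Riemann–von Mangoldt, `ZeroGapsProofs.eventually_mul_log_le`).
[folklore] -/
theorem stub_calibration_END_of_RH_entire_eq_zero : RiemannHypothesis → ∀ {f : ℂ → ℂ},
    Differentiable ℂ f → ∀ {A B : ℝ}, 0 ≤ A →
      (∀ s : ℂ, ‖f s‖ ≤ B * Real.exp (A * |s.re - 1 / 2|)) →
        (∀ ρ ∈ ZetaZeros.riemannZetaNontrivialZeros, f ρ = 0) → ∀ s : ℂ, f s = 0 := by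
  intro hRH f hf A B hA hgrowth hzero
  by_contra hne
  push Not at hne
  obtain ⟨s₀, hs₀⟩ := hne
  have hfs₀ : 0 < ‖f s₀‖ := norm_pos_iff.2 hs₀
  set d : ℝ := ‖s₀ - 1 / 2‖ with hd
  have hd0 : 0 ≤ d := norm_nonneg _
  set B' : ℝ := max B 1 with hB'
  have hB'1 : 1 ≤ B' := le_max_right _ _
  have hB'pos : 0 < B' := one_pos.trans_le hB'1
  have hlog2 : 0 < Real.log 2 := Real.log_pos one_lt_two
  set α : ℝ := 2 * A / Real.log 2 with hα
  set β : ℝ := (Real.log B' + 3 * A * d - Real.log ‖f s₀‖) / Real.log 2 with hβ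
  have hα0 : 0 ≤ α := div_nonneg (by positivity) hlog2.le
  -- Jensen: `N_d(T) ≤ α T + β` for every `T > 0`
  have hJ : ∀ T : ℝ, 0 < T → (distinctZeroCount T : ℝ) ≤ α * T + β := by
    intro T hT
    set r : ℝ := T + d with hr
    have hr0 : 0 < r := by positivity
    set R : ℝ := 2 * r with hR
    set M : ℝ := B' * Real.exp (A * (R + d)) with hM
    have hM1 : 1 ≤ M := by
      have h1 : 1 ≤ Real.exp (A * (R + d)) := Real.one_le_exp (by positivity)
      nlinarith
    have hMpos : 0 < M := one_pos.trans_le hM1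
    have hbound : ∀ z ∈ Metric.sphere s₀ R, ‖f z‖ ≤ M := by
      intro z hz
      rw [Metric.mem_sphere, dist_eq_norm] at hz
      have h1 : |z.re - 1 / 2| ≤ R + d := by
        have h2 : |z.re - 1 / 2| ≤ ‖z - 1 / 2‖ := by
          simpa [sub_re] using abs_re_le_norm (z - 1 / 2)
        have h3 : ‖z - 1 / 2‖ ≤ ‖z - s₀‖ + ‖s₀ - 1 / 2‖ := norm_sub_le_norm_sub_add_norm_sub _ _ _
        linarith
      calc ‖f z‖ ≤ B * Real.exp (A * |z.re - 1 / 2|) := hgrowth z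
        _ ≤ B' * Real.exp (A * |z.re - 1 / 2|) :=
            mul_le_mul_of_nonneg_right (le_max_left _ _) (Real.exp_pos _).le
        _ ≤ B' * Real.exp (A * (R + d)) :=
            mul_le_mul_of_nonneg_left (Real.exp_le_exp.2
              (mul_le_mul_of_nonneg_left h1 hA)) hB'pos.le
    set Z : Finset ℂ := (zetaZeroBox_finite 0 T).toFinset with hZ
    have hZmem : ∀ z ∈ Z, z ∈ Metric.closedBall s₀ r ∧ f z = 0 := by
      intro z hz
      rw [hZ, Set.Finite.mem_toFinset] at hz
      have hnt := zetaZeroBox_subset_riemannZetaNontrivialZeros 0 T hz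
      obtain ⟨-, -, -, him0, himT⟩ := hz
      refine ⟨?_, hzero z hnt⟩
      -- RH: `Re z = 1/2` (a non-trivial zero is neither trivial nor the pole)
      have hre : z.re = 1 / 2 :=
        hRH z (ZetaZeros.riemannZetaNontrivialZeros.zeta_eq_zero hnt)
          (by rintro ⟨n, hn⟩; exact hnt.2 ⟨n, hn.symm⟩)
          (ZetaZeros.riemannZetaNontrivialZeros.ne_one hnt)
      have e : z - 1 / 2 = z.im * I := Complex.ext (by simp [hre]) (by simp)
      have hn : ‖z - 1 / 2‖ = z.im := by
        rw [e, norm_mul, Complex.norm_I, mul_one, Complex.norm_real, Real.norm_eq_abs,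
          abs_of_pos him0]
      rw [Metric.mem_closedBall, dist_eq_norm]
      calc ‖z - s₀‖ ≤ ‖z - 1 / 2‖ + ‖1 / 2 - s₀‖ := norm_sub_le_norm_sub_add_norm_sub _ _ _
        _ = z.im + d := by rw [hn, hd, norm_sub_rev]
        _ ≤ T + d := by linarith
    have hcard := stub_calibration_END_of_RH_card_zeros_le hf hr0 (by linarith) hM1 hs₀
      hbound Z hZmem
    have hcardeq : (distinctZeroCount T : ℝ) = Z.card := by
      rw [distinctZeroCount, Set.ncard_eq_toFinset_card _ (zetaZeroBox_finite 0 T)]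
    have hRr : R / r = 2 := by rw [hR]; field_simp
    have hlogM : Real.log (M / ‖f s₀‖) =
        2 * A * T + (Real.log B' + 3 * A * d - Real.log ‖f s₀‖) := by
      rw [Real.log_div hMpos.ne' hfs₀.ne', hM, Real.log_mul hB'pos.ne' (Real.exp_pos _).ne',
        Real.log_exp, hR, hr]
      ring
    rw [hRr, hlogM] at hcard
    rw [hcardeq]
    calc (Z.card : ℝ) ≤ _ := hcard
      _ = α * T + β := by rw [hα, hβ]; ring
  -- Montgomery (on RH) and Riemann–von Mangoldt
  have h1 := Montgomery1973_distinct_zeros_holds hRH (1 / 3) (by norm_num)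
  have h2 := ZeroGapsProofs.eventually_mul_log_le (ε := 1) one_pos
  obtain ⟨T, hT1, hTlog, hMo, hRvM⟩ := ((eventually_ge_atTop (1 : ℝ)).and
    ((Real.tendsto_log_atTop.eventually_ge_atTop (8 * π * (α + |β|) + 1)).and (h1.and h2))).exists
  have hT0 : 0 < T := one_pos.trans_le hT1
  have hπ : 0 < π := Real.pi_pos
  have hJT := hJ T hT0
  have hN : (zetaZeroCount T : ℝ) ≤ 2 * (α * T + β) := by
    norm_num at hMo
    linarith
  have h3 : T / (2 * π) * Real.log T ≤ 4 * (α * T + β) := by linarith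
  have h4 : β ≤ |β| * T := (le_abs_self β).trans (le_mul_of_one_le_right (abs_nonneg β) hT1)
  have h5 : T * Real.log T ≤ T * (8 * π * (α + |β|)) := by
    rw [div_mul_eq_mul_div, div_le_iff₀ (by positivity)] at h3
    nlinarith
  have h6 : Real.log T ≤ 8 * π * (α + |β|) := le_of_mul_le_mul_left h5 hT0
  linarith

end Summit.RiemannHypothesis.RiemannHypothesis.Theorems.RuelleBandCofiniteCriticalLine

end
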